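import Summits.Ventures.QEC.Census.AdditiveCertCheck
import HarnessLib

/-!
# Additive-code certificates (CalibN01): kernel-checked `[[n,k,d]]` parameters (DATA + KERNEL)

Venture QEC, census calibration (qec-search-5). Each `cert<Id> : AddCert` is a bruteforce certificate in the layout of
`Census/AdditiveCertCheck.lean` (qec-type-02): independent generators as packed Pauli words `(x-mask, z-mask)` (bit `j` =
qubit `j`), symplectic rank partners `rinv`, a weight-`d` witness (a logical with a non-membership witness for `k > 0`,
a stabilizer row-combination for `k = 0`) and the allow-list of every zero-syndrome word of weight `≤ d − 1`; the
checker's soundness theorems give `IsAdditiveCode (span rows) k d`, `minDistance = d` (`k > 0`) and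
`AdditiveCodeExists n k d` (the predicate tabulated in CRSS 1998 Table III [CalderbankEtAl1998, §8]).
Small replays are one `decide`; larger ones use the chunked replay of `Census/AdditiveCertChunks.lean`
(one theorem per (qubit, letter) chunk). Source data: run/shared/lean/pub/qec/census/search-5/addcert_v1/
(generator `code/emit_addcert.py`; this file by `code/emit_addcert_lean.py`).
-/

namespace Summit.Ventures.QEC.Census.Additive

open Summit.Ventures.QEC.Census Literature.InformationTheory.QuantumCodes

/-- Certificate `stab_n1_k0`: an `[[1,0,1]]` additive code (qec-search-5 calibration census cell (CRSS98 Table III, census/search-5/calib-n14)); generators (Pauli words, bit j = qubit j):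
Z; replay size Σ_(w<d) C(n,w)·3^w = 0 words (tier decide). (data, qec-search-5) -/
def certStabN1K0 : AddCert where
  n := 1
  rows := [(0, 1)]
  rinv := [(1, 0)]
  d := 1
  witness := (0, 1)
  witnessCoef := 1
  nonmember := (0, 0)
  found := []

/-- The checker accepts `certStabN1K0` (one-shot `decide`: tier KERNEL). -/
theorem check_certStabN1K0 : certStabN1K0.check = true := by decide

/-- **`[[1,0,1]]` certified** (`stab_n1_k0`). -/
theorem isAdditiveCode_certStabN1K0 : IsAdditiveCode certStabN1K0.code 0 1 :=
  certStabN1K0.isAdditiveCode_of_check check_certStabN1K0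

/-- … and (k = 0) a stabilizer element of weight exactly `1` exists. -/
theorem exists_weight_certStabN1K0 : ∃ v ∈ certStabN1K0.code, sympWeight v = 1 :=
  certStabN1K0.exists_stabilizer_weight_eq_of_check check_certStabN1K0 (by decide)

/-- `[[1,0,1]]` exists (CRSS `AdditiveCodeExists`). -/
theorem additiveCodeExists_1_0_1_StabN1K0 : AdditiveCodeExists 1 0 1 :=
  certStabN1K0.additiveCodeExists_of_check check_certStabN1K0

/-- Certificate `stab_n1_k1`: an `[[1,1,1]]` additive code (qec-search-5 calibration census cell (CRSS98 Table III, census/search-5/calib-n14)); generators (Pauli words, bit j = qubit j):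
(none: k = n); replay size Σ_(w<d) C(n,w)·3^w = 0 words (tier decide). (data, qec-search-5) -/
def certStabN1K1 : AddCert where
  n := 1
  rows := []
  rinv := []
  d := 1
  witness := (1, 0)
  witnessCoef := 0
  nonmember := (0, 1)
  found := []

/-- The checker accepts `certStabN1K1` (one-shot `decide`: tier KERNEL). -/
theorem check_certStabN1K1 : certStabN1K1.check = true := by decide

/-- **`[[1,1,1]]` certified** (`stab_n1_k1`). -/
theorem isAdditiveCode_certStabN1K1 : IsAdditiveCode certStabN1K1.code 1 1 :=
  certStabN1K1.isAdditiveCode_of_check check_certStabN1K1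

/-- … with minimum distance exactly `1`. -/
theorem minDistance_certStabN1K1 : minDistance certStabN1K1.code = 1 :=
  certStabN1K1.minDistance_code_of_check check_certStabN1K1 (by decide)

/-- `[[1,1,1]]` exists (CRSS `AdditiveCodeExists`). -/
theorem additiveCodeExists_1_1_1_StabN1K1 : AdditiveCodeExists 1 1 1 :=
  certStabN1K1.additiveCodeExists_of_check check_certStabN1K1

end Summit.Ventures.QEC.Census.Additive
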